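import Summits.BirchSwinnertonDyer.BirchSwinnertonDyer.Theorems.EisensteinPrimesGoodLatticeBDPValuePublishedFactsOfTextbookTC
import Summits.BirchSwinnertonDyer.BirchSwinnertonDyer.Theorems.EisensteinPrimesIndexInputsShellOfSurC
import HarnessLib

/-!
# v30 «SurC» re-typing of `EisensteinPrimesGoodLatticeBDPValuePublishedFactsOfTextbookTC`: Greenberg 2016 Prop. 2.6.3 by name ↦ its case (c) at totally complex `K` by name

Route `EisensteinPrimes` (rung K5), crux 2 `GoodLatticeBDPValue` (stmt-BirchSwinnertonDyer-19032), line `halves`;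
cell `bsd-eis`, width seat `bsd-line-x1-p1-w5` gen 9 for LEAD g9 (LEAD ROUTING #3, 2026-08-29), helper (`--supports`).

This file re-types, token for token, the theorems of `EisensteinPrimesGoodLatticeBDPValuePublishedFactsOfTextbookTC` that carry Greenberg 2016
Prop. 2.6.3 = Greenberg 2010 Prop. 3.2.1 BY NAME (`h263 : Greenberg2016.prop263_sur_of_crk`: SUR(𝐃, 𝓛) from
LEO + CRK + (a) ∨ (b) ∨ (c), every number field) with that hypothesis replaced by its CASE (c) AT TOTALLY
COMPLEX FIELDS (`h263 : Greenberg2016.prop263_sur_of_crk_caseC_tc`, the special case p696608 appended to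
`Literature/…/Greenberg2016/GlobalToLocalSurjectivity.lean`): every leaf of the line applies Prop. 2.6.3 in case (c)
(`η = 𝔭`, `Q_𝓛(K_𝔭, 𝐃) = 0` divisible) at an imaginary quadratic — hence totally complex — `K`, so the weaker
hypothesis suffices; the special case is the END STATEMENT of the cell's kernel road «SUR-Λ»
(`prop263_sur_of_crk_caseC_tc_holds`, from the tree's Poitou–Tate at totally complex fields), after which the
LEAD drops the name from the line (v30).  Statements are otherwise VERBATIM (same binder order, new names
`<name>_ofSurC`); proofs are the tree proofs with the last argument of the leaf call, the third-disjunct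
injection of the case-(c) witness, replaced by the witness itself (the `IsTotallyComplex K` instance being
supplied from `IsImaginaryQuadratic K`) and the re-typed
callees called; helpers without `h263` are used from the imported `…OfTateTC` file unchanged.

Theorems only; no definition, no named fact, no `sorry`, no instance. HONEST FRAMING: conditional on the PUBLISHED
named facts carried as hypotheses; closes nothing by itself; no summit statement / BSD / the crux is proved here.

## References
* R. Greenberg, *On the structure of Selmer groups*, Springer PROMS 188 (2016), Prop. 2.6.3 (§2.6 p. 10). [Greenberg2016Selmer]
* R. Greenberg, *Surjectivity of the global-to-local map defining a Selmer group*, Kyoto J. Math. 50 (2010), Prop. 3.2.1 (c) (p. 15). [Greenberg2010]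
* (the references of the re-typed file apply verbatim)
-/

-- `Summit.<P>.<Sub>` repeats `BirchSwinnertonDyer` by the tree's layout convention (D-0017)
set_option linter.dupNamespace false

noncomputable section

open scoped Classical

open PowerSeries WeierstrassCurve NumberField IsDedekindDomain Field
  Literature.NumberTheory.GaloisRepresentations Literature.NumberTheory.EllipticCurves.GreenbergVatsal2000
  Literature.NumberTheory.EllipticCurves Literature.NumberTheory.EllipticCurves.ModularForms
  Literature.NumberTheory.EllipticCurves.Rank1Residual Literature.NumberTheory.EllipticCurves.Castella2018
  Literature.NumberTheory.EllipticCurves.GreenbergSelmer Literature.NumberTheory.QuadraticFields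
  Literature.NumberTheory.EllipticCurves.CastellaGrossiLeeSkinner2022
  Literature.NumberTheory.EllipticCurves.KellerYin2024 Literature.NumberTheory.EllipticCurves.IwasawaAlgebra
  Literature.NumberTheory.EllipticCurves.BCGKPST2020
open Literature.NumberTheory.IwasawaTheory Literature.NumberTheory.IwasawaTheory.Greenberg2016
  Literature.NumberTheory.IwasawaTheory.Greenberg2006 Literature.NumberTheory.GaloisCohomology
open Summit.BirchSwinnertonDyer.Rank1Residual.X2.ResidualDevissageModules
  Summit.BirchSwinnertonDyer.BirchSwinnertonDyer.Theorems
namespace Summit.BirchSwinnertonDyer.BirchSwinnertonDyer.Theorems.GoodLatticeBDPValuePublishedFactsOfTextbookTC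

open GoodLatticeBDPValuePublishedFactsOfTextbook

/-- **[v30 `OfSurC` re-typing: Greenberg 2016 Prop. 2.6.3 by name ↦ its case (c) at totally complex `K` by name (`prop263_sur_of_crk_caseC_tc`).]** [cite: Greenberg2010, Prop. 3.2.1 (c) (p. 15)] **`GoodLatticeBDPValueIndexStubs.indexInputs` (closed stub 2a-I of halves v20.2) from Greenberg 2016 Prop. 2.6.3, Tate's global
Euler characteristic and Poitou–Tate 17.13 (a), BOTH AT TOTALLY COMPLEX FIELDS only**: the statement from `∀ W` on is
the registered one VERBATIM (= p660402's `indexInputs_of_textbook` with the second and third antecedents restricted to `[IsTotallyComplex L]`);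
proof: Greenberg 2006 Prop. 4.1 from `prop41_of_tate_of_poitouTate_three_le_of_isTotallyComplex`, Props. 4.2 / §5 A tree theorems, Prop. 3.2 no longer
an input (T28b re-typing: `IndexInputsShell.indexInputs_of_H2_ofSurC`, `IndexInputsH2.natCard_H2_conjunct_ofTateTC` read Tate's
formula in degrees `≤ 2` at the imaginary quadratic `K`), `cd_p ≤ 2` at the imaginary quadratic `K` (§2).
[cite: KellerYin2024, Prop. 1.3.2 and §1.4 (arXiv:2402.12781v2 TeX L700–760, L1178–1330)] [cite: PollackWeston2011, Prop. A.2]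
[cite: Greenberg2016Selmer, Prop. 2.6.3] [cite: MilneADT2006, I Thm. 5.1] [cite: Harari2020, Thm. 17.13 (a), Cor. 17.14]
[cite: Greenberg2006, Props. 3.2, 4.1, 4.2, §5 A] -/
theorem indexInputs_of_textbook_ofSurC :
    prop263_sur_of_crk_caseC_tc →
    (∀ (L : Type) [Field L] [NumberField L] [IsTotallyComplex L], tateGlobalEulerPoincareCharacteristic L) →
    (∀ (L : Type) [Field L] [NumberField L] [IsTotallyComplex L], poitouTate_restricted_three_le L) →
    ∀ (W : WeierstrassCurve ℚ) [W.IsElliptic] [W.IsGloballyMinimal] (p : ℕ) [Fact p.Prime],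
      2 < p → Good W p → Red W p → Anom W p →
      (∀ Φ : AddSubgroup (geomTorsion W (p : ℤ)), IsRationalLine W p Φ → ¬ LineUnramifiedAt W p Φ) →
      ∀ (K : Type) [Field K] [NumberField K], IsImaginaryQuadratic K →
        SatisfiesHeegnerHypothesis (W.conductorNorm ℤ) K → SatisfiesHeegnerHypothesis p K →
        (∀ Q : (W.baseChange K).toAffine.Point, p • Q = 0 → Q = 0) →
      ∀ (ι : K →+* ℚ_[p]) (v vbar : HeightOneSpectrum (𝓞 K)),
        (∀ x : 𝓞 K, x ∈ v.asIdeal ↔ ‖ι (x : K)‖ < 1) →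
        ((p : ℕ) : 𝓞 K) ∈ vbar.asIdeal → vbar ≠ v →
      ∀ (κ : ZpExtension K p), κ.IsAnticyclotomic →
      ∀ (γ : absoluteGaloisGroup K) [Fact (κ.IsTopGenerator γ)],
      ∀ (θsub θquot : FramedGaloisRep K (padicCoeffIntegers (∅ : Set (PadicAlgCl p))) 1),
        IsResidualPairOver (W.baseChange K) p θsub θquot →
      ∀ (Sf : Finset (HeightOneSpectrum (𝓞 K))),
        (∀ w : HeightOneSpectrum (𝓞 K), w ∈ Sf ↔ ((W.conductorNorm ℤ : ℤ) : 𝓞 K) ∈ w.asIdeal) →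
      Module.Finite (IwasawaAlgebra p) (AcSelmer.XAc (W.baseChange K) p κ vbar (↑Sf : Set (HeightOneSpectrum (𝓞 K))) γ) →
      Module.IsTorsion (IwasawaAlgebra p) (AcSelmer.XAc (W.baseChange K) p κ vbar (↑Sf : Set (HeightOneSpectrum (𝓞 K))) γ) →
      muInvariant p (AcSelmer.XAc (W.baseChange K) p κ vbar (↑Sf : Set (HeightOneSpectrum (𝓞 K))) γ) = 0 →
      (∀ D : DatumDualData κ γ (charModule ∅ θsub)
          (AcSelmer.bdpData (charModule ∅ θsub) p vbar) (↑Sf : Set (HeightOneSpectrum (𝓞 K))),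
        Module.Finite (IwasawaAlgebra p) D.X ∧ Module.IsTorsion (IwasawaAlgebra p) D.X ∧ muInvariant p D.X = 0) →
      (∀ D : DatumDualData κ γ (charModule ∅ θquot)
          (AcSelmer.bdpData (charModule ∅ θquot) p vbar) (↑Sf : Set (HeightOneSpectrum (𝓞 K))),
        Module.Finite (IwasawaAlgebra p) D.X ∧ Module.IsTorsion (IwasawaAlgebra p) D.X ∧ muInvariant p D.X = 0) →
      ∃ (c : ℕ) (τ : ℕ → absoluteGaloisGroup K)
        (Φ : StableSubgroup (absoluteGaloisGroup K) ↥((W.baseChange K).geomTorsion (p : ℤ)))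
        (j₁ : Φ.Sub →+ charModule ∅ θsub) (j₃ : Φ.Quot →+ charModule ∅ θquot)
        (hj₁ : ∀ (g : absoluteGaloisGroup K) (a : Φ.Sub), j₁ (g • a) = g • j₁ a)
        (hj₃ : ∀ (g : absoluteGaloisGroup K) (a : Φ.Quot), j₃ (g • a) = g • j₃ a),
        -- (R) representatives
        (∀ i : ℕ, κ (τ i) = Multiplicative.ofAdd ((i : ℕ) : ℤ_[p])) ∧
        (∀ i j : ℕ, i < p ^ c → j < p ^ c → i ≠ j → ∀ δ ∈ decomp vbar,
          Multiplicative.ofAdd ((j : ℕ) : ℤ_[p]) ≠ Multiplicative.ofAdd ((i : ℕ) : ℤ_[p]) * κ δ) ∧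
        (∀ x : subgroupH1 κ.kerSubgroup (charModule ∅ θsub),
          (∀ i, i < p ^ c → resOfLe (charModule ∅ θsub) (inf_le_left : κ.kerSubgroup ⊓ decomp vbar ≤ κ.kerSubgroup) (conjH1 κ.kerSubgroup (charModule ∅ θsub) (τ i) x) = 0) →
            ∀ σ : absoluteGaloisGroup K, resOfLe (charModule ∅ θsub) (inf_le_left : κ.kerSubgroup ⊓ decomp vbar ≤ κ.kerSubgroup) (conjH1 κ.kerSubgroup (charModule ∅ θsub) σ x) = 0) ∧
        (∀ x : subgroupH1 κ.kerSubgroup ↥((W.baseChange K).geomPrimaryTorsion p),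
          (∀ i, i < p ^ c → resOfLe ↥((W.baseChange K).geomPrimaryTorsion p) (inf_le_left : κ.kerSubgroup ⊓ decomp vbar ≤ κ.kerSubgroup) (conjH1 κ.kerSubgroup ↥((W.baseChange K).geomPrimaryTorsion p) (τ i) x) = 0) →
            ∀ σ : absoluteGaloisGroup K, resOfLe ↥((W.baseChange K).geomPrimaryTorsion p) (inf_le_left : κ.kerSubgroup ⊓ decomp vbar ≤ κ.kerSubgroup) (conjH1 κ.kerSubgroup ↥((W.baseChange K).geomPrimaryTorsion p) σ x) = 0) ∧
        (∀ x : subgroupH1 κ.kerSubgroup (charModule ∅ θquot),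
          (∀ i, i < p ^ c → resOfLe (charModule ∅ θquot) (inf_le_left : κ.kerSubgroup ⊓ decomp vbar ≤ κ.kerSubgroup) (conjH1 κ.kerSubgroup (charModule ∅ θquot) (τ i) x) = 0) →
            ∀ σ : absoluteGaloisGroup K, resOfLe (charModule ∅ θquot) (inf_le_left : κ.kerSubgroup ⊓ decomp vbar ≤ κ.kerSubgroup) (conjH1 κ.kerSubgroup (charModule ∅ θquot) σ x) = 0) ∧
        -- the Kummer embeddings
        Function.Injective j₁ ∧ Function.Injective j₃ ∧
        (∀ x : charModule ∅ θsub, x ∈ j₁.range ↔ p • x = 0) ∧ (∀ x : charModule ∅ θquot, x ∈ j₃.range ↔ p • x = 0) ∧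
        (∀ x : ↥((W.baseChange K).geomPrimaryTorsion p), x ∈ (AddSubgroup.inclusion (geomTorsion_le_geomPrimaryTorsion (W.baseChange K) p)).range ↔ p • x = 0) ∧
        (∀ x : ↥((W.baseChange K).geomPrimaryTorsion p), ∃ x' : ↥((W.baseChange K).geomPrimaryTorsion p), p • x' = x) ∧
        -- (U)
        (∀ w : HeightOneSpectrum (𝓞 K), w ∉ (↑Sf : Set (HeightOneSpectrum (𝓞 K))) → ((p : ℕ) : 𝓞 K) ∉ w.asIdeal →
          Function.Injective (resH1Hom (ContinuousMonoidHom.id (inertiaIn κ.kerSubgroup w)) Φ.incl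
            (fun g m ↦ Φ.incl_smul ((g : decomp (K := K) w) : absoluteGaloisGroup K) m))) ∧
        (∀ w : HeightOneSpectrum (𝓞 K), w ∉ (↑Sf : Set (HeightOneSpectrum (𝓞 K))) → ((p : ℕ) : 𝓞 K) ∉ w.asIdeal →
          Function.Injective (resH1Hom (ContinuousMonoidHom.id (inertiaIn κ.kerSubgroup w)) j₁
            (fun g m ↦ hj₁ ((g : decomp (K := K) w) : absoluteGaloisGroup K) m))) ∧
        (∀ w : HeightOneSpectrum (𝓞 K), w ∉ (↑Sf : Set (HeightOneSpectrum (𝓞 K))) → ((p : ℕ) : 𝓞 K) ∉ w.asIdeal →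
          Function.Injective (resH1Hom (ContinuousMonoidHom.id (inertiaIn κ.kerSubgroup w)) (AddSubgroup.inclusion (geomTorsion_le_geomPrimaryTorsion (W.baseChange K) p))
            (fun (g : inertiaIn κ.kerSubgroup w) (m : ↥((W.baseChange K).geomTorsion (p : ℤ))) ↦
              (rfl : (AddSubgroup.inclusion (geomTorsion_le_geomPrimaryTorsion (W.baseChange K) p)) (((g : decomp (K := K) w) : absoluteGaloisGroup K) • m) =
                ((g : decomp (K := K) w) : absoluteGaloisGroup K) • (AddSubgroup.inclusion (geomTorsion_le_geomPrimaryTorsion (W.baseChange K) p)) m)))) ∧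
        (∀ w : HeightOneSpectrum (𝓞 K), w ∉ (↑Sf : Set (HeightOneSpectrum (𝓞 K))) → ((p : ℕ) : 𝓞 K) ∉ w.asIdeal →
          Function.Injective (resH1Hom (ContinuousMonoidHom.id (inertiaIn κ.kerSubgroup w)) j₃
            (fun g m ↦ hj₃ ((g : decomp (K := K) w) : absoluteGaloisGroup K) m))) ∧
        -- SUR
        (∀ y : Fin (p ^ c) → subgroupH1 (κ.kerSubgroup ⊓ decomp vbar) (charModule ∅ θsub), ∃ u ∈ unramifiedOutside κ.kerSubgroup (charModule ∅ θsub) p (↑Sf : Set (HeightOneSpectrum (𝓞 K))),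
          ∀ i : Fin (p ^ c), resOfLe (charModule ∅ θsub) (inf_le_left : κ.kerSubgroup ⊓ decomp vbar ≤ κ.kerSubgroup) (conjH1 κ.kerSubgroup (charModule ∅ θsub) (τ i) u) = y i) ∧
        (∀ y : Fin (p ^ c) → subgroupH1 (κ.kerSubgroup ⊓ decomp vbar) ↥((W.baseChange K).geomPrimaryTorsion p), ∃ u ∈ unramifiedOutside κ.kerSubgroup ↥((W.baseChange K).geomPrimaryTorsion p) p (↑Sf : Set (HeightOneSpectrum (𝓞 K))),
          ∀ i : Fin (p ^ c), resOfLe ↥((W.baseChange K).geomPrimaryTorsion p) (inf_le_left : κ.kerSubgroup ⊓ decomp vbar ≤ κ.kerSubgroup) (conjH1 κ.kerSubgroup ↥((W.baseChange K).geomPrimaryTorsion p) (τ i) u) = y i) ∧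
        (∀ y : Fin (p ^ c) → subgroupH1 (κ.kerSubgroup ⊓ decomp vbar) (charModule ∅ θquot), ∃ u ∈ unramifiedOutside κ.kerSubgroup (charModule ∅ θquot) p (↑Sf : Set (HeightOneSpectrum (𝓞 K))),
          ∀ i : Fin (p ^ c), resOfLe (charModule ∅ θquot) (inf_le_left : κ.kerSubgroup ⊓ decomp vbar ≤ κ.kerSubgroup) (conjH1 κ.kerSubgroup (charModule ∅ θquot) (τ i) u) = y i) ∧
        -- COT
        (∀ s : (datumStrictSelmer κ.kerSubgroup (charModule ∅ θsub) p (AcSelmer.bdpData (charModule ∅ θsub) p vbar) (↑Sf : Set (HeightOneSpectrum (𝓞 K)))), ∃ n : ℕ, p ^ n • s = 0) ∧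
        (∀ s : (datumStrictSelmer κ.kerSubgroup ↥((W.baseChange K).geomPrimaryTorsion p) p (AcSelmer.bdpData ↥((W.baseChange K).geomPrimaryTorsion p) p vbar) (↑Sf : Set (HeightOneSpectrum (𝓞 K)))), ∃ n : ℕ, p ^ n • s = 0) ∧
        (∀ s : (datumStrictSelmer κ.kerSubgroup (charModule ∅ θquot) p (AcSelmer.bdpData (charModule ∅ θquot) p vbar) (↑Sf : Set (HeightOneSpectrum (𝓞 K)))), ∃ n : ℕ, p ^ n • s = 0) ∧
        Finite (AddSubgroup.torsionBy (datumStrictSelmer κ.kerSubgroup (charModule ∅ θsub) p (AcSelmer.bdpData (charModule ∅ θsub) p vbar) (↑Sf : Set (HeightOneSpectrum (𝓞 K)))) (p : ℤ)) ∧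
        Finite (AddSubgroup.torsionBy (datumStrictSelmer κ.kerSubgroup ↥((W.baseChange K).geomPrimaryTorsion p) p (AcSelmer.bdpData ↥((W.baseChange K).geomPrimaryTorsion p) p vbar) (↑Sf : Set (HeightOneSpectrum (𝓞 K)))) (p : ℤ)) ∧
        Finite (AddSubgroup.torsionBy (datumStrictSelmer κ.kerSubgroup (charModule ∅ θquot) p (AcSelmer.bdpData (charModule ∅ θquot) p vbar) (↑Sf : Set (HeightOneSpectrum (𝓞 K)))) (p : ℤ)) ∧
        -- global H⁰
        (∀ x : (charModule ∅ θsub), (∀ g : ↥κ.kerSubgroup, g • x = x) → ∃ x' : (charModule ∅ θsub), (∀ g : ↥κ.kerSubgroup, g • x' = x') ∧ p • x' = x) ∧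
        (∀ x : ↥((W.baseChange K).geomPrimaryTorsion p), (∀ g : ↥κ.kerSubgroup, g • x = x) → ∃ x' : ↥((W.baseChange K).geomPrimaryTorsion p), (∀ g : ↥κ.kerSubgroup, g • x' = x') ∧ p • x' = x) ∧
        (∀ x : (charModule ∅ θquot), (∀ g : ↥κ.kerSubgroup, g • x = x) → ∃ x' : (charModule ∅ θquot), (∀ g : ↥κ.kerSubgroup, g • x' = x') ∧ p • x' = x) ∧
        (∀ n : ↥((W.baseChange K).geomTorsion (p : ℤ)), (∀ g : ↥κ.kerSubgroup, g • n = n) → n = 0) ∧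
        Finite {n : Φ.Quot // ∀ g : ↥κ.kerSubgroup, g • n = n} ∧
        Nat.card {n : Φ.Quot // ∀ g : ↥κ.kerSubgroup, g • n = n} = p ^ (if ∀ σ : absoluteGaloisGroup K, θquot σ = 1 then 1 else 0) ∧
        -- local H⁰ at `H ⊓ D_v̄`
        (∀ n : Φ.Sub, (∀ g : ↥(κ.kerSubgroup ⊓ decomp vbar), g • n = n) → n = 0) ∧
        (∀ (g : ↥(κ.kerSubgroup ⊓ decomp vbar)) (n : Φ.Quot), g • n = n) ∧
        Finite Φ.Quot ∧ Nat.card Φ.Quot = p ∧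
        (∀ x : (charModule ∅ θsub), (∀ g : ↥(κ.kerSubgroup ⊓ decomp vbar), g • x = x) → ∃ x' : (charModule ∅ θsub), (∀ g : ↥(κ.kerSubgroup ⊓ decomp vbar), g • x' = x') ∧ p • x' = x) ∧
        (∀ x : (charModule ∅ θquot), (∀ g : ↥(κ.kerSubgroup ⊓ decomp vbar), g • x = x) → ∃ x' : (charModule ∅ θquot), (∀ g : ↥(κ.kerSubgroup ⊓ decomp vbar), g • x' = x') ∧ p • x' = x) ∧
        -- H² bookkeeping
        Nat.card (↥(unramifiedOutside κ.kerSubgroup Φ.Quot p (↑Sf : Set (HeightOneSpectrum (𝓞 K)))) ⧸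
            ((unramifiedOutside κ.kerSubgroup ↥((W.baseChange K).geomTorsion (p : ℤ)) p (↑Sf : Set (HeightOneSpectrum (𝓞 K)))).map (resH1Hom (ContinuousMonoidHom.id ↥κ.kerSubgroup) Φ.proj
              (fun g b ↦ Φ.proj_smul (g : absoluteGaloisGroup K) b))).addSubgroupOf
                (unramifiedOutside κ.kerSubgroup Φ.Quot p (↑Sf : Set (HeightOneSpectrum (𝓞 K))))) *
            Nat.card (ModN (unramifiedOutside κ.kerSubgroup ↥((W.baseChange K).geomPrimaryTorsion p) p (↑Sf : Set (HeightOneSpectrum (𝓞 K)))) p) =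
          Nat.card (ModN (unramifiedOutside κ.kerSubgroup (charModule ∅ θsub) p (↑Sf : Set (HeightOneSpectrum (𝓞 K)))) p) * Nat.card (ModN (unramifiedOutside κ.kerSubgroup (charModule ∅ θquot) p (↑Sf : Set (HeightOneSpectrum (𝓞 K)))) p) := by
  intro h263 hT ha W _ _ p _ hp hgood hred hanom hlat K _ _ hK hH hHp htor ι v vbar hv hvbar hne
    κ hκ γ _ θsub θquot hpair Sf hSf hfgS htorS hμS hSsub hSquot
  have h41 : prop41_globalEulerPoincareCorank := prop41_of_tate_of_poitouTate_three_le_of_isTotallyComplex hT ha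
  exact IndexInputsShell.indexInputs_of_H2_ofSurC h263 h41 prop42_localEulerPoincareCorank_holds
    sec5A_localH2_subsingleton_of_LOC1_holds hT W p hp hanom hlat K hK hH htor ι v vbar hv hvbar hne κ hκ γ
    θsub θquot hpair Sf hSf hfgS htorS hμS hSsub hSquot
    (fun Φ j₁ j₃ hj₁ hj₃ _ _ hj₁inj hj₃inj hr₁ hr₃ ↦ IndexInputsH2.natCard_H2_conjunct_ofTateTC
      (groupCdLE_two_of_poitouTate_tc_of_isImaginaryQuadratic ha hK) h41 prop42_localEulerPoincareCorank_holds
      sec5A_localH2_subsingleton_of_LOC1_holds hT W hp hK hH hv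
      hvbar hne κ hκ γ hpair Sf hSf hSsub hSquot Φ j₁ j₃ hj₁ hj₃ hj₁inj hj₃inj hr₁ hr₃)

end Summit.BirchSwinnertonDyer.BirchSwinnertonDyer.Theorems.GoodLatticeBDPValuePublishedFactsOfTextbookTC

end
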